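import Summits.CriticalPhenomena.PercolationContinuityZ3.Theorems.PercBurnResprinkleUniformDiminishmentEstimates
import Literature.Probability.Percolation.GrimmettMarstrand
import Literature.Probability.Percolation.CriticalContinuityProofs
import Summits.CriticalPhenomena.PercolationContinuityZ3.Theses.PercBurnResprinkle

/-!
# Uniform diminishment on `ℤ³` (8/8): the theorem `PercBurnResprinkle.UniformDiminishment`

Item `stmt-CriticalPhenomena-7206` (support, route `PercBurnResprinkle`): for every `R` there is `g > 0`
such that for EVERY `R`-dense `D ⊆ ℤ³`, every `p ≤ p_c(ℤ³) + g` and every vertex `x`, `P_p`-a.s. the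
cluster of `x` in `{e ∈ ω : both endpoints off D}` is finite — the quenched Aizenman–Grimmett strict
inequality `p_c(ℤ³ ∖ D) ≥ p_c(ℤ³) + g(R)` uniformly in the deleted set (Aizenman–Grimmett 1991;
Grimmett 1999 Thm (3.16) and the remark on diminishments; constants uniform because the surgery of the
preceding files has radii and windows depending on `R` alone).

Proof (this file): below `p_c` the full cluster is finite a.s.; on `[p_c, p_c + g]` thin `D` to one
point per tile of side `2h+1` (`h = 3R+1`) centred at `x + (2h+1)ℤ³`, bound the probability by
`Θ_L(p,0)` of the restoration-enhanced model (`measureReal_deleted_le_enhMeasure`), run the line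
argument `Θ_L(p,0) ≤ Θ_L(p - κt₁, t₁)` of the in-tree engine (`AGLine.theta_line_mono` with
`locMod_event`), bound by `P_{p-κt₁}(C(x) leaves the window)` (`enhMeasure_le_measureReal_far`), and let
`L → ∞` (`le_zero_of_le_measureReal_far`, `p - κt₁ < p_c`). The constants `μ₀, κ, t₁, g` depend on
`p_c(ℤ³) ∈ (0,1)` and on `R` only.
-/

namespace Summit.CriticalPhenomena.PercolationContinuityZ3.Theorems

open Literature.Probability.Percolation Literature.Probability.LatticeModels

open MeasureTheory UnifDim in
/-- **Uniform Aizenman–Grimmett diminishment on `ℤ³`** (item `stmt-CriticalPhenomena-7206`): for every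
`R` there is `g > 0` such that for every `R`-dense `D ⊆ ℤ³`, every `p ≤ p_c(ℤ³) + g` and every vertex
`x`, `P_p`-a.s. the cluster of `x` using only edges with both endpoints off `D` is finite.

Proof. Below `p_c` this is `θ_x(p) = 0`. For `p ∈ [p_c, p_c + g]`: thin `D` to one point per tile of
side `2h+1` centred at `x + (2h+1)ℤ³` (`h = 3R+1`); the probability in question is at most
`Θ_L(p, 0)` for the restoration-enhanced model on the window of radius `L(2h+1)+h` around `x`
(`measureReal_deleted_le_enhMeasure`), which by the Aizenman–Grimmett line argument on the in-tree
engine (`AGLine.theta_line_mono`, fed by `locMod_event` with constants depending on `R` only) is at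
most `Θ_L(p - κt₁, t₁) ≤ P_{p-κt₁}(C(x) leaves the window)` (`enhMeasure_le_measureReal_far`), and
`p - κt₁ < p_c`; letting `L → ∞` (`le_zero_of_le_measureReal_far`) gives `0`. -/
theorem UniformDiminishment_proof :
    Summit.CriticalPhenomena.PercolationContinuityZ3.Theses.PercBurnResprinkle.UniformDiminishment := by
  intro R
  classical
  -- constants depending on `R` only
  set h : ℕ := 3 * R + 1 with hh_def
  have hh : 3 * R < h := by omega
  set NE : ℕ := 12 * (2 * (2 * (h + R + 1)) + 1) ^ 3 with hNE
  set NV : ℕ := 2 * (2 * (h + R) + 1) ^ 3 with hNV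
  set NM : ℕ := 6 * (2 * (h + R) + 1) ^ 3 with hNM
  set pc : ℝ := criticalProb (zdGraph 3) (0 : Site 3) with hpc
  have hpc0 : 0 < pc := criticalProb_zd_pos 3 (by norm_num)
  have hpc1 : pc < 1 := criticalProb_zd_lt_one (by norm_num)
  set μ₀ : ℝ := min (pc / 4) ((1 - pc) / 2) with hμ₀
  have hμ₀_pos : 0 < μ₀ := lt_min (by linarith) (by linarith)
  have hμ₀_le : μ₀ ≤ 1 := (min_le_left _ _).trans (by linarith)
  set C : ℝ := AGLine.AGconst NE NV NM μ₀ with hC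
  have hNM1 : (1 : ℝ) ≤ NM := by
    have : 1 ≤ NM := by
      rw [hNM]; exact le_trans (by norm_num) (Nat.le_mul_of_pos_right 6 (pow_pos (Nat.succ_pos _) 3))
    exact_mod_cast this
  have hC_pos : 0 < C := by
    rw [hC, AGLine.AGconst]
    have h1 : (0 : ℝ) < (μ₀ ^ NE)⁻¹ := inv_pos.2 (pow_pos hμ₀_pos _)
    have h2 : (0 : ℝ) < 2 ^ (NE + NV) := by positivity
    have h3 : (0 : ℝ) < NM := by linarith
    exact mul_pos (mul_pos h1 h2) h3
  set κ : ℝ := 1 / C with hκ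
  have hκ_pos : 0 < κ := by rw [hκ]; positivity
  have hκC : κ * C ≤ 1 := by rw [hκ, one_div, inv_mul_cancel₀ hC_pos.ne']
  set t₁ : ℝ := min (1 / 2) (pc / (4 * κ)) with ht₁
  have ht₁_pos : 0 < t₁ := lt_min (by norm_num) (by positivity)
  have ht₁_half : t₁ ≤ 1 / 2 := min_le_left _ _
  have hκt₁ : κ * t₁ ≤ pc / 4 := by
    have : t₁ ≤ pc / (4 * κ) := min_le_right _ _
    calc κ * t₁ ≤ κ * (pc / (4 * κ)) := mul_le_mul_of_nonneg_left this hκ_pos.le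
      _ = pc / 4 := by field_simp
  have hκt₁_pos : 0 < κ * t₁ := mul_pos hκ_pos ht₁_pos
  set g : ℝ := min (κ * t₁ / 2) ((1 - pc) / 2) with hg
  have hg_pos : 0 < g := lt_min (by positivity) (by linarith)
  refine ⟨g, hg_pos, ?_⟩
  intro D hDdense p hp x
  -- the event in question lies inside `{|C(x)| = ∞}`
  set E : Set (Set (Sym2 (Site 3))) := {ω | (openCluster {e | e ∈ ω ∧ ∀ y ∈ e, y ∉ D} x).Infinite} with hE
  have hpcx : criticalProb (zdGraph 3) x = pc := (criticalProb_eq_of_reachable _ (zdGraph_reachable 0 x)).symm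
  by_cases hplt : (p : ℝ) < pc
  · -- below `p_c`: the full cluster is already finite a.s.
    have hsub : E ⊆ percolatesAt x := by
      intro ω hω
      refine Set.Infinite.mono (fun y hy => ?_) hω
      exact SimpleGraph.Reachable.mono (SimpleGraph.fromEdgeSet_mono fun e he => he.1) hy
    have hθ : theta (zdGraph 3) x p = 0 :=
      theta_eq_zero_of_lt_criticalProb_holds (zdGraph 3) x p (by rw [hpcx]; exact hplt)
    have h0 : bondPercolation (zdGraph 3) p (percolatesAt x) = 0 :=
      (measureReal_eq_zero_iff (measure_ne_top _ _)).1 hθ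
    exact measure_mono_null hsub h0
  push Not at hplt
  -- the window `[p_c, p_c + g]`: Aizenman–Grimmett
  have hp_le : (p : ℝ) ≤ pc + g := hp
  have hg1 : g ≤ κ * t₁ / 2 := min_le_left _ _
  have hg2 : g ≤ (1 - pc) / 2 := min_le_right _ _
  set p' : ℝ := (p : ℝ) - κ * t₁ with hp'
  have hp'lt : p' < pc := by rw [hp']; linarith
  have hlo : μ₀ ≤ (p : ℝ) - κ * t₁ := by
    have : μ₀ ≤ pc / 4 := min_le_left _ _
    linarith
  have hhi : (p : ℝ) ≤ 1 - μ₀ := by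
    have : μ₀ ≤ (1 - pc) / 2 := min_le_right _ _
    linarith
  have hp'0 : 0 ≤ p' := hμ₀_pos.le.trans hlo
  have hp'1 : p' ≤ 1 := by rw [hp']; linarith [p.2.2]
  set P' : unitInterval := ⟨p', hp'0, hp'1⟩ with hP'
  set T₁ : unitInterval := ⟨t₁, ht₁_pos.le, ht₁_half.trans (by norm_num)⟩ with hT₁
  -- thin `D` to one point per tile
  choose dsel hdselD hdselnear using fun j : Site 3 => hDdense fun i => x i + (2 * h + 1) * j i
  set D' : Set (Site 3) := Set.range dsel with hD'
  have hD'mem : ∀ y, y ∈ D' ↔ ∃ j, dsel j = y := fun y => Set.mem_range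
  have hD'D : D' ⊆ D := by rintro y ⟨j, rfl⟩; exact hdselD j
  have hnear : ∀ j i, -(R : ℤ) ≤ dsel j i - x i - (2 * h + 1) * j i ∧
      dsel j i - x i - (2 * h + 1) * j i ≤ R := by
    intro j i
    have := (mem_box.1 (hdselnear j)) i
    simp only [Pi.sub_apply] at this
    constructor <;> linarith [this.1, this.2]
  -- the model
  set av : Set (Sym2 (Site 3) ⊕ Site 3) → Set (Sym2 (Site 3)) := fun ξ =>
    {f | Sum.inl f ∈ ξ ∧ f ∈ (zdGraph 3).edgeSet ∧ ∀ y ∈ f, y ∈ D' → Sum.inr y ∈ ξ} with hav_def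
  have hav : ∀ ξ f, f ∈ av ξ ↔ Sum.inl f ∈ ξ ∧ f ∈ (zdGraph 3).edgeSet ∧ ∀ y ∈ f, y ∈ D' → Sum.inr y ∈ ξ :=
    fun _ _ => Iff.rfl
  -- the chain of inequalities at scale `L ≥ 1`
  have hchain : ∀ L : ℕ, 1 ≤ L → (bondPercolation (zdGraph 3) p).real E ≤
      (bondPercolation (zdGraph 3) P').real
        {ω | ∃ v, (openGraph ω).Reachable x v ∧ v - x ∉ box 3 (L * (2 * h + 1) + h)} := by
    intro L hL
    set r : ℕ := L * (2 * h + 1) + h with hr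
    set A : Set (Set (Sym2 (Site 3) ⊕ Site 3)) :=
      {ξ | ∃ v, (openGraph (av ξ)).Reachable x v ∧ v - x ∉ box 3 r} with hA_def
    have hA : ∀ ξ, ξ ∈ A ↔ ∃ v, (openGraph (av ξ)).Reachable x v ∧ v - x ∉ box 3 r := fun _ => Iff.rfl
    set KV : Finset (Site 3) := (box 3 (r + 1)).image (· + x) with hKV
    set KE : Finset (Sym2 (Site 3)) := edgesIn (zdGraph 3) KV with hKE
    have hKE_edge : ∀ e ∈ KE, e ∈ (zdGraph 3).edgeSet := fun e he => (mem_edgesIn_iff.1 he).1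
    have hdet := determinedBy_event hav hA
    have hup : IsUpperSet A := isUpperSet_event hav hA
    have hmod := locMod_event hav hA hD'mem hnear hh hr hL
    have hNEb : ∀ e ∈ KE, (edgesTouching (zdGraph 3)
        (((box 3 (2 * (h + R + 1))).image (· + (EnhProp42.ends e).1)) ∪
          ((box 3 (2 * (h + R + 1))).image (· + (EnhProp42.ends e).2)))).card ≤ NE :=
      fun e _ => card_CE_le h R e
    have hNVb : ∀ e ∈ KE, (((box 3 (h + R)).image (· + (EnhProp42.ends e).1)) ∪
        ((box 3 (h + R)).image (· + (EnhProp42.ends e).2))).card ≤ NV := fun e _ => card_CV_le h R e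
    have h00 : ((0 : unitInterval) : ℝ) = 0 := rfl
    calc (bondPercolation (zdGraph 3) p).real E
        ≤ (EnhProp42.enhMeasure (zdGraph 3) p 0).real A := measureReal_deleted_le_enhMeasure hav hA hD'D p 0
      _ = AGLine.Theta KE KV A p 0 := by
          rw [← h00, theta_eq_enhMeasure_real hKE_edge hdet p 0]
      _ ≤ AGLine.Theta KE KV A ((p : ℝ) - κ * t₁) t₁ :=
          AGLine.theta_line_mono hup hmod hNEb hNVb (fun y _ => card_filter_mem_CV_le h R hKE_edge y)
            hμ₀_pos hμ₀_le hκ_pos.le hκC ht₁_pos.le ht₁_half hlo hhi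
      _ = (EnhProp42.enhMeasure (zdGraph 3) P' T₁).real A := by
          rw [← theta_eq_enhMeasure_real hKE_edge hdet P' T₁]
      _ ≤ _ := enhMeasure_le_measureReal_far hav hA P' T₁
  -- the limit `L → ∞`
  have hθ' : theta (zdGraph 3) x P' = 0 :=
    theta_eq_zero_of_lt_criticalProb_holds (zdGraph 3) x P' (by rw [hpcx]; exact hp'lt)
  have hq : (bondPercolation (zdGraph 3) p).real E ≤ 0 := by
    refine le_zero_of_le_measureReal_far (o := x) hθ' (rad := fun L => (L + 1) * (2 * h + 1) + h)
      (fun L L' hLL' => by nlinarith) (fun L => by nlinarith) fun L => ?_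
    exact hchain (L + 1) (by omega)
  have hq0 : (bondPercolation (zdGraph 3) p).real E = 0 := le_antisymm hq measureReal_nonneg
  exact (measureReal_eq_zero_iff (measure_ne_top _ _)).1 hq0

end Summit.CriticalPhenomena.PercolationContinuityZ3.Theorems
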